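import Literature.MathematicalPhysics.QuantumFieldTheory.Balaban1983to89.B9Thm311ClassCompactnessZdPerNested
import Literature.MathematicalPhysics.QuantumFieldTheory.Balaban1983to89.B9Thm33SocketUniformLevelsZdPer

/-!
# `Balaban1983to89.B9Thm33GlobalBlockWitnessZdPerNested` — [Balaban1985BackgroundPropagators] Thm 3.3 p. 399 ∕ (3.47), (3.45) p. 398 ∕ [Balaban1984PropagatorsII] (2.22)
# p. 226 AT EVERY NESTED PERIODIC MEMBER (print's class (1.31) `towerBondsP`, every truncation `m ≤ k`), PER MEMBER, for the GENUINE periodic record `opsAllZdPer`: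
# UNIFORM COERCIVITY of `Δ_a(U₀)` on the compact small-plaquette class, the pointwise bound `‖(G_𝔤^per(U₀)J)(b)‖ ≤ N·|J|₍₋₃₎` in the member's region-keyed norm, and
# the junction's binders `GlobAtIPer … aT B₀` ((3.47)@−3) AND `HolderAtIH2Per … aT (2B₀(Lᵐ)^β) β len` ((3.45), both-points edition, any `0 ≤ β`) INHABITED with ONE
# threshold `aT` — the N05 witness slot's displayed `hglob` and `hhol` at the member.  dag-n06-b g24's `B9Thm33GlobalBlockWitnessZdPer` (all-torus member) generalised
# through `B9Thm311ClassCompactnessZdPerNested`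

statement-level skeleton of published theorems with citation tags; proofs where landed; nothing here is a claim about the Yang–Mills mass gap

`[Balaban1985BackgroundPropagators]` ("B9", CMP **99** (1985) 389–434): Thm 3.3 p. 399 (uniformity in `Ω_j`), (3.40), (3.42) p. 397, (3.43)–(3.47) p. 398, (3.26)–(3.27) p. 395, Thm 3.11
p. 416.  `[Balaban1984PropagatorsII]` ("B6", CMP **96**) (2.22) p. 226 *«Δ_a is bounded from below by a positive constant»*.  `[Balaban1985RegularSpaces]` ("B8", CMP **99**)
(1.1) p. 76, (1.7) p. 77, (1.3)–(1.6) p. 77, (1.31) p. 82, p. 86 (the norms `|·|_{(γ)}`), (1.58)–(1.59) p. 86, p. 77 «Ω_j ⊂ T_η».  `[Balaban1985Averaging]` Prop. 2 p. 26.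

CITATION HEADER (lean-in-tree rule).  Cell `pub-ymgap` (YM Track A), DAG node N06 = [B9], seat `pub-ymgap-dag-n06-b` (g25), the (β′-PERIODIC) road; own take of HANDOFF §2r (b).
WHY: after `B9Thm311ClassCompactnessZdPerNested` (`InvAtHIPer` per member) the N05 witness slot of record still displays `hglob ∕ hhol ∕ hsrc ∕ hsrcH` at every nested periodic
member; dag-n06-b g24 proved them at `torusIdx` only, and its Hölder knit `holderAtIPer_of_globAtIPer_of_len` and lit-balaban t2s's `holderAtIPer_zero_of_globAtIPer` READ the
gradient entry of (3.47), hence need «Ω_j = ℤᵈ» at every level.  THIS FILE: §1 `η³‖J(b)‖ ≤ |J|₍₋₃,Ω₎` for ANY region sequence with `Ω₀ = ℤᵈ` (the level-`0` term sees every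
bond); §2 the two positivity neighbourhoods of the flat set at the member within the all-`ℤᵈ` canonical regime set (g24's `…_of_flat` ∕ `…_of_base` theorems with the member
inputs of `B9Thm311FlatHolonomyKernelZdPerNested` §3); §3 g24's coercivity assembly with the member generalised (swallowing lemma for the joint property, compact class
`{unitary, periodic, plaquettes α-close}` inside the all-`ℤᵈ` canonical regime, g24's engine `exists_coercive_per_of_isCompact`); §4 (2.22) + Young + the fibre comparison
⟹ the pointwise bound; §5 the three (3.47) entries AND the Hölder quotient from the SAME pointwise bound — the covariant gradient is bounded EVERYWHERE, so no «Ω_j = ℤᵈ».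

WHAT IS PROVED (kernel, 0 sorry; theorems only — no `def`, no `instance`, no `notation`).
* §1 `eta_cube_mul_norm_le_bondNorm_per_of_zero`.
* §2 ★★★ `IdxB8SubDPer.bondPairPer_pos_eventually_canonicalUniv_of_flat`, ★★ `IdxB8SubDPer.scalarPos_eventually_of_flat`.
* §3 ★★★★ `IdxB8SubDPer.exists_coercive_plaqNear` (`∃ α c > 0`: every unitary periodic `U₀` with plaquettes `α`-close: `RegularAtHPer ∧ c⟨A,A⟩_per ≤ ⟨A, Δ_a(U₀)A⟩_per`).
* §4 ★★★ `IdxB8SubDPer.exists_apply_bound_gopZdHPer_plaqNear` (`∃ α > 0, N ≥ 0`: `‖(G_𝔤^per(U₀)J)(b)‖ ≤ N·|J|₍₋₃,Ω₎`).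
* §5 ★★★★ `IdxB8SubDPer.glob_holderAtIH2Per_opsAllZdPer` (`∃ aT B₀ > 0`: `GlobAtIPer P θ.L (opsAllZdPer τ θ.L P (towerBondsP …) ops₀) aT B₀ M a.toZdIdx m ∧ ∀ β ≥ 0, ∀ len`
  (integer lengths), `HolderAtIH2Per … aT (2B₀(Lᵐ)^β) β len M a.toZdIdx m`), ★★★★ `IdxB8SubDPer.globAtIPer_opsAllZdPer`, `gop_mem_domSubHPer_opsAllZdPer`.

HONEST SCOPE.  (i) QUALITATIVE and PER MEMBER (compactness constants `α, c, N, aT, B₀` depend on the member, `P`, `τ`, the record); the N05 head displays ONE `aT, B₀ᴺ, C_β` for all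
members — NOT proved here (volume-uniformity ∕ η-scaling = the coercivity ∕ random-walk lanes); no estimate of [B9] in print's uniform form.  (ii) The source binders
(`SrcAtIPer ∕ SrcHolderAtIH2Per`) at nested members are NOT touched (successor file: g24's `B9Thm33SourceWitnessZdPer` §3–§4 need only `Ω₀ = ℤᵈ`).  (iii) `0 < D` displayed.
(iv) Count-neutral; N06 NOT discharged; K1⁹ NOT closed; counts UNMOVED; one finite `𝕋⁴` programme at fixed `ε`, Bałaban as printed; nothing continuum ∕ ℝ⁴ ∕ OS ∕ mass gap ∕ Clay.
Unit `pub-ymgap-dag-n06-b` (g25), 2026-08-28; NEW file importing this seat's `B9Thm311ClassCompactnessZdPerNested` and `B9Thm33SocketUniformLevelsZdPer` (g24); modifies nothing.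
Net new unproved facts: 0.
-/

noncomputable section

namespace Literature.MathematicalPhysics.QuantumFieldTheory.Balaban1983to89.B9Thm33GlobalBlockWitnessZdPerNested

open Filter Topology
open B7Prop1Explicit B7Eq78Linearization
open B7Prop2Explicit (unitaryUnits unitaryUnits_le_U1 avgIter)
open B7Prop1Local (InBox loK bondHiK)
open B8Ineq132 (covDerivFwd plaqF InAk BondTouches)
open B8Eq140Level (SideTouches)
open B8ScaledSupNorm (bondNorm msup weight Bdd)
open B8Eq138LandauZd (covLap)
open B8Eq119TwistedAxial (bgT)
open B8LeafModelZd (ZdIdx)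
open T4TermwiseTorus (IsPeriodic box tcls tlift tlift_mem_box)
open B9SupplySockB9P3ZdLetters (OpsZd deltaAOf)
open B9SupplySockB9P3ZdLettersOmega (norm_covDerivFwd_le norm_covLap_le)
open B9SupplySockB9P3ZdGammaInAkDpZd (withDpZd)
open B9Eq316AveragingTransposeZd (tauForm tauForm_apply Reg17 alphaQ alphaQ_pos qQ betaTau)
open B9Eq316AveragingTransposeZdPrinted (withQQP)
open B9Eq327GreenZd (LinearOnDomAt)
open B9Eq327GreenZdHermPer (domSubHPer mem_domSubHPer_iff finiteDimensional_domSubHPer RegularAtHPer bondPairPer mem_domSub_univ gopZdHPer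
  gopZdHPer_mem_domSubHPer isPeriodic_apply_dir)
open B9Eq321LandauProjectionZdPer (perSub formPer)
open B9Eq324DeltaPrimeAZdPer (deltaPrimeAPer RegularPrimePer bijective_of_form_pos)
open B9Eq325QGGQInvZdPer (QprimeStarPerInjective)
open B9Thm31CoercivePrimeCompactZd (isCompact_unitary_plaqClosed reg17Univ_of_forall_plaqF_le)
open B9Thm311PosDefOpenRegimeZd (wcx_avgIter_lt_one_of_reg17UnivP)
open B9Thm311PosDefNearFlatZd (bgT_mem_unitaryUnits_of_reg17UnivP)
open B9SupplySockB9P3ZdAllLettersZdPer (opsLandauPer opsAllZdPer deltaAOf_opsAllZdPer_apply linearOnDomAt_opsAllZdPer_univ regularAtHPer_opsAllZdPer_of_pos)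
open B9SupplySockB9P3ZdPer (GlobAtIPer HolderAtIPer)
open B9Thm311OpenAtFlatHolonomyZdPer (norm_Wcx_avgIter_sub_one_lt_one_of_flat formPer_deltaPrimeAPer_self_pos_of_flat regularPrimePer_eventually_of_base
  bondPairPer_pos_eventually_opsAllZdPer_of_flat lettersContinuousWithinAt_opsAllZdPer_of_base reg17_of_flat bgT_mem_unitaryUnits_of_flat)
open B9Thm311ClassCompactnessZdPer (isClosed_isPeriodic exists_plaq_threshold_of_open_superset_flat)
open B9Thm33GlobalBlockWitnessCubeZd (exists_norm_sq_le_re_trace)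
open B9Thm311FlatPropagatorBoundZdPer (bondPairPer_le_young deltaAOf_gopZdHPer_of_mem)
open B9Thm33GlobalBlockWitnessZdPer (exists_coercive_per_of_isCompact)
open B9Thm311FlatHolonomyKernelZdPerNested (IdxB8SubDPer.isPeriodic_towerBondsP_Λs IdxB8SubDPer.towerBondsP_box IdxB8SubDPer.exists_periodic_label
  IdxB8SubDPer.qprimeStarPerInjective IdxB8SubDPer.bondPairPer_deltaAOf_opsAllZdPer_pos_of_flat)
open B9Thm311ClassCompactnessZdPerNested (norm_plaqF_sub_one_le_of_inAk_zero reg17_of_reg17_univ)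
open B8TowerBondsPrinted (towerBondsP)
open Node00 (Stage3Params IdxB8SubD IdxB8SubDPer)

-- `Site` alone could resolve to the torus sites of `Setup.lean`; re-export the `ℤ^d` sites of `B7Prop1Explicit`.
export B7Prop1Explicit (Site)

variable {d : ℕ} {𝔸 : Type*} [CStarAlgebra 𝔸]

/-! ## §1  `η³‖J(b)‖ ≤ |J|₍₋₃₎` for a periodic field over ANY region sequence with `Ω₀ = ℤᵈ` -/

section Pointwise0

variable {L P : ℕ} [NeZero P]

/-- **A PERIODIC BOND FIELD'S `|·|₍₋₃₎`-FAMILY OVER A REGION SEQUENCE WITH `Ω₀ = ℤᵈ` IS BOUNDED, AND `η³‖J(b)‖ ≤ |J|₍₋₃₎` AT EVERY BOND** (the level-`0` term of the norm sees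
every bond; the weights `(Lʲη)³ ≤ (Lᵐη)³`; the values of a `P`-periodic field lie among its values on one period cell).  dag-n06-b g24's `eta_cube_mul_norm_le_bondNorm_per` is the
all-`ℤᵈ` sequence. [cite: Balaban1985RegularSpaces, p.86 (definition of `|·|_{(γ)}`), p.77 («Ω_j ⊂ T_η», Ω₀ the torus); Balaban1985BackgroundPropagators, (3.41) p.397] -/
theorem eta_cube_mul_norm_le_bondNorm_per_of_zero (hL : 1 ≤ L) (m : ℕ) {η : ℝ} (hη : 0 < η) {Ω : ℕ → Set (Site d)} (hΩ : Ω 0 = Set.univ)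
    {J : Site d → Fin d → 𝔸} (hJ : IsPeriodic P J) (y : Site d) (μ : Fin d) :
    η ^ 3 * ‖J y μ‖ ≤ bondNorm L m η (-(3 : ℝ)) Ω J := by
  classical
  have e3 : (-(3 : ℝ)) = -((3 : ℕ) : ℝ) := by norm_num
  have hLr : (1 : ℝ) ≤ L := by exact_mod_cast hL
  have hbd : ∀ b : Site d × Fin d, ‖J b.1 b.2‖ ≤ ∑ κ : Fin d, ∑ ξ : Fin d → ZMod P, ‖J (tlift ξ) κ‖ := by
    rintro ⟨x, κ⟩
    calc ‖J x κ‖ ≤ ∑ ξ : Fin d → ZMod P, ‖J (tlift ξ) κ‖ := B9B8KnitHolderZeroOfGlob.norm_le_sum_box_of_isPeriodic (isPeriodic_apply_dir hJ κ) x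
      _ ≤ ∑ κ' : Fin d, ∑ ξ : Fin d → ZMod P, ‖J (tlift ξ) κ'‖ :=
          Finset.single_le_sum (f := fun κ' : Fin d => ∑ ξ : Fin d → ZMod P, ‖J (tlift ξ) κ'‖)
            (fun _ _ => Finset.sum_nonneg fun _ _ => norm_nonneg _) (Finset.mem_univ κ)
  have hBdd : Bdd L m η (-(3 : ℝ)) (fun j (b : Site d × Fin d) => BondTouches (Ω j) b.1 b.2) (fun b => J b.1 b.2) := by
    refine B8ScaledSupNorm.bdd_of_forall (c := ((L : ℝ) ^ m * η) ^ 3 * ∑ κ : Fin d, ∑ ξ : Fin d → ZMod P, ‖J (tlift ξ) κ‖) fun j hj b _ => ?_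
    rw [e3, B8ScaledSupNorm.weight_neg_natCast]
    have hw : ((L : ℝ) ^ j * η) ^ 3 ≤ ((L : ℝ) ^ m * η) ^ 3 := by
      apply pow_le_pow_left₀ (by positivity)
      exact mul_le_mul_of_nonneg_right (pow_le_pow_right₀ hLr hj) hη.le
    exact mul_le_mul hw (hbd b) (norm_nonneg _) (by positivity)
  have h := B8ScaledSupNorm.weight_mul_norm_le_msup hBdd (Nat.zero_le m) (i := (y, μ)) (Or.inl (by rw [hΩ]; exact Set.mem_univ y))
  rw [e3, B8ScaledSupNorm.weight_neg_natCast, pow_zero, one_mul] at h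
  exact h

end Pointwise0

/-! ## §2  Positivity near the flat set at a nested periodic member, all-`ℤᵈ` canonical regime set (vector form, scalar form) -/

section NearFlat

variable {θ : Stage3Params} [FiniteDimensional ℝ θ.𝔸] (τ : θ.𝔸 →ₗ[ℂ] ℂ) (hτp : ∀ x : θ.𝔸, x ≠ 0 → 0 < (τ (star x * x)).re)
  (hτt : ∀ x y : θ.𝔸, τ (x * y) = τ (y * x)) (hτs : ∀ x : θ.𝔸, τ (star x) = starRingEnd ℂ (τ x)) {P : ℕ} [NeZero P]

include hτp hτt hτs in
/-- ★★★ **POSITIVITY OF THE GENUINE PERIODIC `Δ_a(U₀)` NEAR EVERY FLAT BACKGROUND AT A NESTED PERIODIC MEMBER, ALL-`ℤᵈ` CANONICAL REGIME SET** (print's class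
`towerBondsP`, `m ≤ k`): for every flat unitary `P`-periodic `U₁`, `⟨A, Δ_a(U₀)A⟩_per > 0` on `E_𝔤^per(P) ∖ 0` for all `U₀` NEAR `U₁` WITHIN `{unitary, P-periodic,
Reg17 L m ℤᵈ (α_Q∕L²), Ūʲ(Γ) unitary for j ≤ m}` — dag-n06-b g24's `bondPairPer_pos_eventually_opsAllZdPer_of_flat` with the member-specific hypotheses supplied by
`B9Thm311FlatHolonomyKernelZdPerNested` §3. [cite: Balaban1985BackgroundPropagators, Thm 3.11 p.416, (3.26) p.395; Balaban1985RegularSpaces, (1.7) p.77, (1.3)–(1.6) p.77, (1.31) p.82] -/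
theorem IdxB8SubDPer.bondPairPer_pos_eventually_canonicalUniv_of_flat (a : IdxB8SubDPer θ P) {m : ℕ} (hm : m ≤ a.toZdIdx.k)
    (ops₀ : ℝ → ZdIdx θ.D θ.L → ℕ → OpsZd θ.D θ.𝔸) (M : ℝ) {U₁ : Site θ.D → Fin θ.D → θ.𝔸ˣ}
    (hU₁ : ∀ x κ, U₁ x κ ∈ unitaryUnits θ.𝔸) (hU₁per : IsPeriodic P U₁) (hflat : ∀ (κ ν : Fin θ.D) (x : Site θ.D), plaqF U₁ κ ν x = 1) :
    ∀ᶠ U₀ in 𝓝[{U₀ : Site θ.D → Fin θ.D → θ.𝔸ˣ | (∀ (x : Site θ.D) (κ : Fin θ.D), U₀ x κ ∈ unitaryUnits θ.𝔸) ∧ IsPeriodic P U₀ ∧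
        Reg17 θ.L m (fun _ => (Set.univ : Set (Site θ.D))) (alphaQ θ.D θ.L / (θ.L : ℝ) ^ 2) U₀ ∧
        ∀ j, j ≤ m → ∀ (x y : Site θ.D), bgT θ.L U₀ j x y ∈ unitaryUnits θ.𝔸}] U₁,
      ∀ A ∈ domSubHPer (d := θ.D) (𝔸 := θ.𝔸) P, A ≠ 0 →
        0 < bondPairPer τ P A (deltaAOf a.toZdIdx.η
          (opsAllZdPer τ θ.L P (fun k j => towerBondsP θ.L a.toZdIdx.Ω (a.toZdIdx.Λs k) j) ops₀ M a.toZdIdx m) U₀ A) := by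
  haveI : NeZero θ.L := ⟨by have := θ.two_le_L; omega⟩
  have hL1 : 1 ≤ θ.L := le_trans (by norm_num) θ.two_le_L
  have hL0 : (0 : ℝ) < θ.L := by exact_mod_cast (lt_of_lt_of_le (by norm_num) θ.two_le_L)
  obtain ⟨j₀, hj₀, y₀, hy₀, -⟩ := IdxB8SubDPer.exists_periodic_label a hm
  exact bondPairPer_pos_eventually_opsAllZdPer_of_flat τ hτp hτt hτs θ.two_le_L (fun k j => towerBondsP θ.L a.toZdIdx.Ω (a.toZdIdx.Λs k) j) ops₀ M a.toZdIdx m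
    (a.dvd_level hm) (fun j hj => a.isPeriodic_Λs hm hj) hj₀ ⟨y₀, hy₀⟩ (fun j _ hj => IdxB8SubDPer.towerBondsP_box a m j hj)
    ⟨hU₁, hU₁per, reg17_of_flat hL1 m _ (div_pos (alphaQ_pos θ.D hL1) (pow_pos hL0 2)) hflat, fun j _ x y => bgT_mem_unitaryUnits_of_flat θ.L hU₁ hflat j x y⟩
    hU₁ hU₁per hflat (fun U₀ hU₀ => hU₀.1) (fun U₀ hU₀ => hU₀.2.1) (fun U₀ hU₀ => reg17_of_reg17_univ a.toZdIdx.Ω hU₀.2.2.1) (fun U₀ hU₀ => hU₀.2.2.2)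
    (fun U₀ _ => IdxB8SubDPer.qprimeStarPerInjective a hm U₀)
    (fun A hA hA0 => IdxB8SubDPer.bondPairPer_deltaAOf_opsAllZdPer_pos_of_flat τ hτt hτs hτp a hm ops₀ M hU₁ hU₁per hflat hA hA0)

include hτp hτt in
/-- ★★ **THE SCALAR FORM `⟨f, Δ′_a(U₀)f⟩_{T_P} > 0` NEAR EVERY FLAT PERIODIC BACKGROUND, IN THE FULL NEIGHBOURHOOD FILTER, FOR A NESTED MEMBER'S FAMILIES** (weights `a ≡ 1`,
`m ≤ k`): g24's `regularPrimePer_eventually_of_base` at a flat `U₁` with the scalar positivity at `U₁` from `formPer_deltaPrimeAPer_self_pos_of_flat` (one non-empty periodic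
level). [cite: Balaban1985BackgroundPropagators, Thm 3.11 p.416 («Δ′_a … positive definite»), (3.24) p.394] -/
theorem IdxB8SubDPer.scalarPos_eventually_of_flat (a : IdxB8SubDPer θ P) {m : ℕ} (hm : m ≤ a.toZdIdx.k) {U₁ : Site θ.D → Fin θ.D → θ.𝔸ˣ}
    (hU₁ : ∀ x κ, U₁ x κ ∈ unitaryUnits θ.𝔸) (hU₁per : IsPeriodic P U₁) (hflat : ∀ (κ ν : Fin θ.D) (x : Site θ.D), plaqF U₁ κ ν x = 1) :
    ∀ᶠ U₀ in 𝓝 U₁, ∀ f : perSub (𝔸 := θ.𝔸) (d := θ.D) P, f ≠ 0 →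
      0 < formPer τ P f (deltaPrimeAPer θ.L U₀ a.toZdIdx.η m (fun _ => (1 : ℝ)) (a.toZdIdx.Λs m) P f) := by
  haveI : NeZero θ.L := ⟨by have := θ.two_le_L; omega⟩
  have hL1 : 1 ≤ θ.L := le_trans (by norm_num) θ.two_le_L
  obtain ⟨j₀, hj₀, y₀, hy₀, -⟩ := IdxB8SubDPer.exists_periodic_label a hm
  have hposS : ∀ f : perSub (𝔸 := θ.𝔸) (d := θ.D) P, f ≠ 0 →
      0 < formPer τ P f (deltaPrimeAPer θ.L U₁ a.toZdIdx.η m (fun _ => (1 : ℝ)) (a.toZdIdx.Λs m) P f) :=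
    fun f hf => formPer_deltaPrimeAPer_self_pos_of_flat τ a.toZdIdx.hη.ne' hL1 hτt hτp (a.dvd_level hm) (fun _ => zero_le_one) hj₀ zero_lt_one
      (a.isPeriodic_Λs hm hj₀) ⟨y₀, hy₀⟩ hU₁ hU₁per hflat hf
  have h := regularPrimePer_eventually_of_base τ (fun i' _ q κ r => norm_Wcx_avgIter_sub_one_lt_one_of_flat θ.L hU₁ hflat i' q κ r) hposS
    (Set.univ : Set (Site θ.D → Fin θ.D → θ.𝔸ˣ)) (η := a.toZdIdx.η) (m := m) (a := fun _ => (1 : ℝ)) (Λs := a.toZdIdx.Λs m)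
  rw [nhdsWithin_univ] at h
  exact h.mono fun U₀ hU₀ => hU₀.1

end NearFlat

/-! ## §3  Uniform coercivity and regularity on the compact small-plaquette class at a nested periodic member -/

section Coercive

variable {θ : Stage3Params} [FiniteDimensional ℝ θ.𝔸] (τ : θ.𝔸 →ₗ[ℂ] ℂ) (hτp : ∀ x : θ.𝔸, x ≠ 0 → 0 < (τ (star x * x)).re)
  (hτt : ∀ x y : θ.𝔸, τ (x * y) = τ (y * x)) (hτs : ∀ x : θ.𝔸, τ (star x) = starRingEnd ℂ (τ x)) {P : ℕ} [NeZero P]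

include hτp hτt hτs in
/-- ★★★★ **[4] p. 226 «Δ_a IS BOUNDED FROM BELOW BY A POSITIVE CONSTANT» AT A NESTED PERIODIC MEMBER, FOR THE WHOLE CLOSED SMALL-PLAQUETTE CLASS AT ONCE.**  For `0 < D`,
`a : IdxB8SubDPer θ P`, `m ≤ k`, a faithful Hermitian tracial `τ`: there are `α > 0` and `c > 0` such that EVERY unitary `P`-periodic `U₀` ALL of whose plaquette variables are
`α`-close to `1` has, for the genuine periodic record at `a` over print's class: `RegularAtHPer` AND `c·⟨A, A⟩_per ≤ ⟨A, Δ_a(U₀)A⟩_per` for every `A ∈ E_𝔤^per(P)`.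
dag-n06-b g24's `exists_coercive_plaqNear_torusIdx` with the member generalised (all-`ℤᵈ` canonical regime; §2; g24's engine `exists_coercive_per_of_isCompact`).
[cite: Balaban1984PropagatorsII, p.226; Balaban1985BackgroundPropagators, Thm 3.11 p.416, (3.26)–(3.27) p.395; Balaban1985RegularSpaces, (1.7) p.77, (1.3)–(1.6) p.77, (1.31) p.82; Balaban1985Averaging, Prop. 2 p.26] -/
theorem IdxB8SubDPer.exists_coercive_plaqNear (hD : 0 < θ.D) (a : IdxB8SubDPer θ P) {m : ℕ} (hm : m ≤ a.toZdIdx.k)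
    (ops₀ : ℝ → ZdIdx θ.D θ.L → ℕ → OpsZd θ.D θ.𝔸) (M : ℝ) :
    ∃ α : ℝ, 0 < α ∧ ∃ c : ℝ, 0 < c ∧ ∀ U₀ : Site θ.D → Fin θ.D → θ.𝔸ˣ, (∀ (x : Site θ.D) (κ : Fin θ.D), U₀ x κ ∈ unitaryUnits θ.𝔸) → IsPeriodic P U₀ →
      (∀ (x : Site θ.D) (κ ν : Fin θ.D), ‖plaqF U₀ κ ν x - 1‖ ≤ α) →
        RegularAtHPer a.toZdIdx.η
          (opsLandauPer τ P (withDpZd (withQQP τ θ.L (fun k j => towerBondsP θ.L a.toZdIdx.Ω (a.toZdIdx.Λs k) j) ops₀)) M a.toZdIdx m) P U₀ ∧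
        ∀ A ∈ domSubHPer (d := θ.D) (𝔸 := θ.𝔸) P,
          c * bondPairPer τ P A A ≤
            bondPairPer τ P A (deltaAOf a.toZdIdx.η
              (opsAllZdPer τ θ.L P (fun k j => towerBondsP θ.L a.toZdIdx.Ω (a.toZdIdx.Λs k) j) ops₀ M a.toZdIdx m) U₀ A) := by
  haveI : NeZero θ.L := ⟨by have := θ.two_le_L; omega⟩
  have hL2 := θ.two_le_L
  have hL1 : 1 ≤ θ.L := le_trans (by norm_num) hL2
  have hL0 : (0 : ℝ) < θ.L := by exact_mod_cast (lt_of_lt_of_le (by norm_num) hL2)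
  set i : ZdIdx θ.D θ.L := a.toZdIdx with hi
  set 𝔅 : ℕ → ℕ → Set (Site θ.D × Fin θ.D) := fun k j => towerBondsP θ.L i.Ω (i.Λs k) j with h𝔅
  have hP : θ.L ^ m ∣ P := a.dvd_level hm
  have hΛ : ∀ j, j ≤ m → IsPeriodic (P / θ.L ^ j) fun y => y ∈ i.Λs m j := fun j hj => a.isPeriodic_Λs hm hj
  have hΛb : ∀ j, j ≤ m → ∀ κ : Fin θ.D, IsPeriodic (P / θ.L ^ j) (fun z => (z, κ) ∈ 𝔅 m j) := fun j hj κ => IdxB8SubDPer.isPeriodic_towerBondsP_Λs a hm hj κ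
  have hbox : ∀ j, 1 ≤ j → j ≤ m → ∀ c ∈ 𝔅 m j, ∀ x, InBox (loK θ.L j c.1) (bondHiK θ.L j c.1 c.2) x → x ∈ i.Ω (j - 1) :=
    fun j _ hj => IdxB8SubDPer.towerBondsP_box a m j hj
  have hinj : ∀ U₀ : Site θ.D → Fin θ.D → θ.𝔸ˣ, QprimeStarPerInjective (𝔸 := θ.𝔸) P θ.L U₀ m (i.Λs m) := fun U₀ => IdxB8SubDPer.qprimeStarPerInjective a hm U₀
  -- the all-`ℤᵈ` canonical regime set, the two positivity properties and the joint good set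
  set 𝒰 : Set (Site θ.D → Fin θ.D → θ.𝔸ˣ) := {U₀ | (∀ (x : Site θ.D) (κ : Fin θ.D), U₀ x κ ∈ unitaryUnits θ.𝔸) ∧ IsPeriodic P U₀ ∧
      Reg17 θ.L m (fun _ => (Set.univ : Set (Site θ.D))) (alphaQ θ.D θ.L / (θ.L : ℝ) ^ 2) U₀ ∧
      ∀ j, j ≤ m → ∀ (x y : Site θ.D), bgT θ.L U₀ j x y ∈ unitaryUnits θ.𝔸} with h𝒰
  set PosV : (Site θ.D → Fin θ.D → θ.𝔸ˣ) → Prop := fun U₀ => ∀ A ∈ domSubHPer (d := θ.D) (𝔸 := θ.𝔸) P, A ≠ 0 →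
      0 < bondPairPer τ P A (deltaAOf i.η (opsAllZdPer τ θ.L P 𝔅 ops₀ M i m) U₀ A) with hPosV
  set PosS : (Site θ.D → Fin θ.D → θ.𝔸ˣ) → Prop := fun U₀ => ∀ f : perSub (𝔸 := θ.𝔸) (d := θ.D) P, f ≠ 0 →
      0 < formPer τ P f (deltaPrimeAPer θ.L U₀ i.η m (fun _ => (1 : ℝ)) (i.Λs m) P f) with hPosS
  set N₀ : Set (Site θ.D → Fin θ.D → θ.𝔸ˣ) := interior {U₀ | (U₀ ∈ 𝒰 → PosV U₀) ∧ PosS U₀} with hN₀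
  have hN₀open : IsOpen N₀ := isOpen_interior
  have hflatN : ∀ U : Site θ.D → Fin θ.D → θ.𝔸ˣ, (∀ (x : Site θ.D) (κ : Fin θ.D), U x κ ∈ unitaryUnits θ.𝔸) → IsPeriodic P U →
      (∀ (κ ν : Fin θ.D) (x : Site θ.D), plaqF U κ ν x = 1) → U ∈ N₀ := by
    intro U hUu hUp hUf
    have h1 := IdxB8SubDPer.bondPairPer_pos_eventually_canonicalUniv_of_flat τ hτp hτt hτs a hm ops₀ M hUu hUp hUf
    rw [eventually_nhdsWithin_iff] at h1
    have h2 := IdxB8SubDPer.scalarPos_eventually_of_flat τ hτp hτt a hm hUu hUp hUf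
    refine mem_interior_iff_mem_nhds.2 (Filter.mem_of_superset (Filter.inter_mem h1 h2) fun U₀ hU₀ => ?_)
    exact ⟨fun h𝒰 => hU₀.1 h𝒰, hU₀.2⟩
  obtain ⟨α₁, hα₁, hswallow⟩ := exists_plaq_threshold_of_open_superset_flat P hN₀open hflatN
  -- the threshold: inside the swallowed set and strictly inside the all-`ℤᵈ` class (1.7) at window `α_Q∕L²`
  obtain ⟨β, hβ_def⟩ : ∃ β : ℝ, β = alphaQ θ.D θ.L / (θ.L : ℝ) ^ 2 * (((θ.L : ℝ) ^ m)⁻¹) ^ 2 := ⟨_, rfl⟩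
  have hβ : 0 < β := by rw [hβ_def]; exact mul_pos (div_pos (alphaQ_pos θ.D hL1) (pow_pos hL0 2)) (by positivity)
  set α : ℝ := min α₁ (β / 2) with hα
  have hα0 : 0 < α := lt_min hα₁ (by positivity)
  have hαβ : α < β := (min_le_right _ _).trans_lt (by linarith)
  -- the compact class
  set K : Set (Site θ.D → Fin θ.D → θ.𝔸ˣ) := {U₀ | (∀ x κ, U₀ x κ ∈ unitaryUnits θ.𝔸) ∧ ∀ (x : Site θ.D) (μ ν : Fin θ.D), ‖plaqF U₀ μ ν x - 1‖ ≤ α} ∩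
      {U₀ | IsPeriodic P U₀} with hK
  have hKc : IsCompact K := (isCompact_unitary_plaqClosed α).inter_right (isClosed_isPeriodic P)
  have hKreg : ∀ U₀ ∈ K, Reg17 θ.L m (fun _ => (Set.univ : Set (Site θ.D))) (alphaQ θ.D θ.L / (θ.L : ℝ) ^ 2) U₀ := by
    intro U₀ hU₀
    exact reg17Univ_of_forall_plaqF_le hL1 m (by rw [← hβ_def]; exact hαβ) hU₀.1.2
  have hK𝒰 : K ⊆ 𝒰 := fun U₀ hU₀ =>
    ⟨hU₀.1.1, hU₀.2, hKreg U₀ hU₀, bgT_mem_unitaryUnits_of_reg17UnivP hD hL2 m hU₀.1.1 (hKreg U₀ hU₀)⟩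
  have hKN : K ⊆ N₀ := fun U₀ hU₀ => hswallow U₀ hU₀.1.1 hU₀.2 fun x κ ν => (hU₀.1.2 x κ ν).trans (min_le_left _ _)
  have hKgood : ∀ U₀ ∈ K, PosV U₀ ∧ PosS U₀ := fun U₀ hU₀ =>
    ⟨(interior_subset (hKN hU₀)).1 (hK𝒰 hU₀), (interior_subset (hKN hU₀)).2⟩
  -- the refined regime set on which the `D R^per D*` letter is continuous
  set 𝒰' : Set (Site θ.D → Fin θ.D → θ.𝔸ˣ) := 𝒰 ∩ {U₀ | RegularPrimePer θ.L U₀ i.η m (fun _ => (1 : ℝ)) (i.Λs m) P} with h𝒰'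
  have hK𝒰' : K ⊆ 𝒰' := fun U₀ hU₀ => ⟨hK𝒰 hU₀, bijective_of_form_pos τ (hKgood U₀ hU₀).2⟩
  have hlin : ∀ U₀ ∈ 𝒰', LinearOnDomAt i.η (opsAllZdPer τ θ.L P 𝔅 ops₀ M i m) (Set.univ : Set (Site θ.D)) U₀ :=
    fun U₀ hU₀ => linearOnDomAt_opsAllZdPer_univ τ P hL2 𝔅 ops₀ M i m hbox hU₀.1.1
  have hcont : ∀ U₁ ∈ K, ∀ A ∈ domSubHPer (d := θ.D) (𝔸 := θ.𝔸) P, ∀ (y : Site θ.D) (μ : Fin θ.D),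
      ContinuousWithinAt (fun U₀ => deltaAOf i.η (opsAllZdPer τ θ.L P 𝔅 ops₀ M i m) U₀ A y μ) K U₁ := by
    intro U₁ hU₁ A hA y μ
    have hsmall : ∀ i', i' < m + 1 → ∀ (q : Site θ.D) (κ : Fin θ.D) (r : Fin θ.D → Fin θ.L),
        ‖((Wcx θ.L (avgIter θ.L U₁ i') q κ (boxVec θ.L r) : θ.𝔸ˣ) : θ.𝔸) - 1‖ < 1 :=
      fun i' hi' q κ r => wcx_avgIter_lt_one_of_reg17UnivP hD hL2 m hU₁.1.1 (hKreg U₁ hU₁) i' (Nat.lt_succ_iff.1 hi') q κ r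
    have h := lettersContinuousWithinAt_opsAllZdPer_of_base τ hτp hτt hτs 𝔅 ops₀ M i m (fun _ => (1 : ℝ)) hL1 hP hΛ
      (hK𝒰' hU₁) hsmall (fun U hU => hU.1.1) (fun U hU => hU.1.2.1) (fun U hU => reg17_of_reg17_univ i.Ω hU.1.2.2.1) (fun U hU => hU.1.2.2.2)
      (fun U hU => hU.2) (fun U _ => hinj U) hA y μ
    exact h.mono hK𝒰'
  have hpos : ∀ U₀ ∈ K, ∀ A ∈ domSubHPer (d := θ.D) (𝔸 := θ.𝔸) P, A ≠ 0 →
      0 < bondPairPer τ P A (deltaAOf i.η (opsAllZdPer τ θ.L P 𝔅 ops₀ M i m) U₀ A) :=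
    fun U₀ hU₀ => (hKgood U₀ hU₀).1
  obtain ⟨c, hc, hcoer⟩ := exists_coercive_per_of_isCompact τ hK𝒰' hKc hlin hcont hpos
  refine ⟨α, hα0, c, hc, fun U₀ hU₀ hper hnear => ?_⟩
  have hUK : U₀ ∈ K := ⟨⟨hU₀, fun x μ ν => hnear x μ ν⟩, hper⟩
  refine ⟨?_, fun A hA => hcoer U₀ hUK A hA⟩
  exact regularAtHPer_opsAllZdPer_of_pos τ P hL2 hτp hτt hτs 𝔅 ops₀ M i hU₀ hper hP hΛb hbox (hpos U₀ hUK)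

end Coercive

/-! ## §4  The pointwise bound `‖(G_𝔤^per(U₀)J)(b)‖ ≤ N·|J|₍₋₃₎` on the class at a nested periodic member ([4] (2.22) + the fibre comparison) -/

section Pointwise

variable {θ : Stage3Params} [FiniteDimensional ℝ θ.𝔸] (τ : θ.𝔸 →ₗ[ℂ] ℂ) (hτp : ∀ x : θ.𝔸, x ≠ 0 → 0 < (τ (star x * x)).re)
  (hτt : ∀ x y : θ.𝔸, τ (x * y) = τ (y * x)) (hτs : ∀ x : θ.𝔸, τ (star x) = starRingEnd ℂ (τ x)) {P : ℕ} [NeZero P]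

include hτp hτt hτs in
/-- ★★★ **A SUP-NORM BOUND FOR THE GENUINE PERIODIC PROPAGATOR ON THE CLOSED SMALL-PLAQUETTE CLASS AT A NESTED PERIODIC MEMBER**: `∃ α > 0, ∃ N ≥ 0`: every unitary
`P`-periodic `U₀` whose plaquette variables are all `α`-close to `1`, every periodic Hermitian `J`, every bond `b`: `RegularAtHPer` and `‖(G_𝔤^per(U₀)J)(b)‖ ≤ N·|J|₍₋₃,Ω₎`
(the member's own region-keyed norm; its level-`0` term sees every bond since `Ω₀ = ℤᵈ`) — [4] (2.22) from §3's coercivity, Young's inequality and `Δ_a(U₀)A = J`, plus the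
finite-dimensional comparison on the period cell.  dag-n06-b g24's `exists_apply_bound_gopZdHPer_plaqNear_torusIdx` with the member generalised.
[cite: Balaban1984PropagatorsII, (2.22) p.226; Balaban1985BackgroundPropagators, Thm 3.3 p.399, (3.47) p.398, (3.27) p.395; Balaban1985RegularSpaces, p.86, (1.3)–(1.6) p.77, (1.31) p.82] -/
theorem IdxB8SubDPer.exists_apply_bound_gopZdHPer_plaqNear (hD : 0 < θ.D) {Cτ : ℝ} (hCτ : ∀ x y : θ.𝔸, |(τ (star x * y)).re| ≤ Cτ * ‖x‖ * ‖y‖)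
    (a : IdxB8SubDPer θ P) {m : ℕ} (hm : m ≤ a.toZdIdx.k) (ops₀ : ℝ → ZdIdx θ.D θ.L → ℕ → OpsZd θ.D θ.𝔸) (M : ℝ) :
    ∃ α : ℝ, 0 < α ∧ ∃ N : ℝ, 0 ≤ N ∧ ∀ U₀ : Site θ.D → Fin θ.D → θ.𝔸ˣ, (∀ (x : Site θ.D) (κ : Fin θ.D), U₀ x κ ∈ unitaryUnits θ.𝔸) → IsPeriodic P U₀ →
      (∀ (x : Site θ.D) (κ ν : Fin θ.D), ‖plaqF U₀ κ ν x - 1‖ ≤ α) →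
        RegularAtHPer a.toZdIdx.η
          (opsLandauPer τ P (withDpZd (withQQP τ θ.L (fun k j => towerBondsP θ.L a.toZdIdx.Ω (a.toZdIdx.Λs k) j) ops₀)) M a.toZdIdx m) P U₀ ∧
        ∀ J : Site θ.D → Fin θ.D → θ.𝔸, J ∈ domSubHPer (d := θ.D) (𝔸 := θ.𝔸) P → ∀ (y : Site θ.D) (μ : Fin θ.D),
          ‖gopZdHPer a.toZdIdx.η
              (opsLandauPer τ P (withDpZd (withQQP τ θ.L (fun k j => towerBondsP θ.L a.toZdIdx.Ω (a.toZdIdx.Λs k) j) ops₀)) M a.toZdIdx m) P U₀ J y μ‖ ≤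
            N * bondNorm θ.L m a.toZdIdx.η (-(3 : ℝ)) a.toZdIdx.Ω J := by
  classical
  have hL2 := θ.two_le_L
  have hL1 : 1 ≤ θ.L := le_trans (by norm_num) hL2
  set i : ZdIdx θ.D θ.L := a.toZdIdx with hi
  have hη : 0 < i.η := i.hη
  obtain ⟨α, hα, c, hc, h⟩ := IdxB8SubDPer.exists_coercive_plaqNear τ hτp hτt hτs hD a hm ops₀ M
  obtain ⟨κ, hκ, hκle⟩ := exists_norm_sq_le_re_trace τ hτp
  have hCτ0 : 0 ≤ Cτ := by
    have h1 := hCτ 1 1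
    rw [star_one, one_mul, norm_one, mul_one, mul_one] at h1
    exact le_trans (abs_nonneg _) h1
  obtain ⟨K, hK_def⟩ : ∃ K : ℝ, K = (θ.D : ℝ) * ((box (d := θ.D) P).card : ℝ) * Cτ / (κ * c ^ 2) := ⟨_, rfl⟩
  have hK0 : 0 ≤ K := by rw [hK_def]; positivity
  refine ⟨α, hα, max 1 K * i.η⁻¹ ^ 3, by positivity, fun U₀ hU₀ hper hnear => ?_⟩
  obtain ⟨hreg, hcoer⟩ := h U₀ hU₀ hper hnear
  refine ⟨hreg, fun J hJ y μ => ?_⟩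
  set o : OpsZd θ.D θ.𝔸 := opsLandauPer τ P (withDpZd (withQQP τ θ.L (fun k j => towerBondsP θ.L i.Ω (i.Λs k) j) ops₀)) M i m with ho
  obtain ⟨A, hA_def⟩ : ∃ A : Site θ.D → Fin θ.D → θ.𝔸, A = gopZdHPer i.η o P U₀ J := ⟨_, rfl⟩
  obtain ⟨nJ, hnJ_def⟩ : ∃ nJ : ℝ, nJ = bondNorm θ.L m i.η (-(3 : ℝ)) i.Ω J := ⟨_, rfl⟩
  rw [← hA_def, ← hnJ_def]
  have hnJ0 : 0 ≤ nJ := by rw [hnJ_def]; exact B8ScaledSupNorm.msup_nonneg θ.L m hη.le _ _ _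
  have hAmem : A ∈ domSubHPer (d := θ.D) (𝔸 := θ.𝔸) P := by rw [hA_def]; exact gopZdHPer_mem_domSubHPer i.η o P U₀ J
  have hAper : IsPeriodic P A := ((mem_domSubHPer_iff P A).1 hAmem).1
  -- (3.27): `Δ_a(U₀)A = J`
  have hΔA : deltaAOf i.η o U₀ A = J := by rw [hA_def]; exact deltaAOf_gopZdHPer_of_mem P hreg hJ
  -- coercivity at `A` and Young: ⟨A, A⟩ ≤ c⁻² ⟨J, J⟩
  have hcA : c * bondPairPer τ P A A ≤ bondPairPer τ P A J := by
    have h1 := hcoer A hAmem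
    rw [show deltaAOf i.η (opsAllZdPer τ θ.L P (fun k j => towerBondsP θ.L i.Ω (i.Λs k) j) ops₀ M i m) U₀ A = deltaAOf i.η o U₀ A from rfl, hΔA] at h1
    exact h1
  have hyoung := bondPairPer_le_young τ P hτs hτp A J hc
  have hAA : bondPairPer τ P A A ≤ c⁻¹ ^ 2 * bondPairPer τ P J J := by
    have h2 : c * bondPairPer τ P A A ≤ c / 2 * bondPairPer τ P A A + 1 / (2 * c) * bondPairPer τ P J J := hcA.trans hyoung
    have h3 : c / 2 * bondPairPer τ P A A ≤ 1 / (2 * c) * bondPairPer τ P J J := by linarith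
    have h4 : 2 / c * (c / 2 * bondPairPer τ P A A) ≤ 2 / c * (1 / (2 * c) * bondPairPer τ P J J) := mul_le_mul_of_nonneg_left h3 (by positivity)
    have e1 : 2 / c * (c / 2 * bondPairPer τ P A A) = bondPairPer τ P A A := by field_simp
    have e2 : 2 / c * (1 / (2 * c) * bondPairPer τ P J J) = c⁻¹ ^ 2 * bondPairPer τ P J J := by field_simp
    rw [e1, e2] at h4
    exact h4
  -- ‖J(b)‖ ≤ η⁻³|J| everywhere
  have hJb : ∀ (x : Site θ.D) (κ' : Fin θ.D), ‖J x κ'‖ ≤ i.η⁻¹ ^ 3 * nJ := by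
    intro x κ'
    have h1 : i.η ^ 3 * ‖J x κ'‖ ≤ bondNorm θ.L m i.η (-(3 : ℝ)) i.Ω J :=
      eta_cube_mul_norm_le_bondNorm_per_of_zero (𝔸 := θ.𝔸) (P := P) hL1 m hη a.Ω_zero ((mem_domSubHPer_iff P J).1 hJ).1 x κ'
    rw [← hnJ_def] at h1
    have hη3 : 0 < i.η ^ 3 := by positivity
    rw [inv_pow, ← div_eq_inv_mul, le_div_iff₀ hη3]
    linarith [h1]
  -- ⟨J, J⟩ ≤ D·#cell·C_τ·(η⁻³|J|)²
  have hJJ : bondPairPer τ P J J ≤ (θ.D : ℝ) * ((box (d := θ.D) P).card : ℝ) * (Cτ * (i.η⁻¹ ^ 3 * nJ) ^ 2) := by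
    have hterm : ∀ (μ' : Fin θ.D) (x : Site θ.D), (τ (star (J x μ') * J x μ')).re ≤ Cτ * (i.η⁻¹ ^ 3 * nJ) ^ 2 := by
      intro μ' x
      calc (τ (star (J x μ') * J x μ')).re ≤ Cτ * ‖J x μ'‖ * ‖J x μ'‖ := (le_abs_self _).trans (hCτ _ _)
        _ ≤ Cτ * (i.η⁻¹ ^ 3 * nJ) * (i.η⁻¹ ^ 3 * nJ) := by
            apply mul_le_mul (mul_le_mul_of_nonneg_left (hJb x μ') hCτ0) (hJb x μ') (norm_nonneg _) (by positivity)
        _ = Cτ * (i.η⁻¹ ^ 3 * nJ) ^ 2 := by ring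
    calc bondPairPer τ P J J = ∑ μ' : Fin θ.D, ∑ x ∈ box (d := θ.D) P, (τ (star (J x μ') * J x μ')).re := rfl
      _ ≤ ∑ μ' : Fin θ.D, ∑ x ∈ box (d := θ.D) P, Cτ * (i.η⁻¹ ^ 3 * nJ) ^ 2 :=
          Finset.sum_le_sum fun μ' _ => Finset.sum_le_sum fun x _ => hterm μ' x
      _ = (θ.D : ℝ) * ((box (d := θ.D) P).card : ℝ) * (Cτ * (i.η⁻¹ ^ 3 * nJ) ^ 2) := by
          rw [Finset.sum_const, Finset.sum_const, Finset.card_univ, Fintype.card_fin, nsmul_eq_mul, nsmul_eq_mul]; ring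
  -- κ‖A(b)‖² ≤ ⟨A, A⟩ (move `b` into the period cell by periodicity)
  have hx₀ : tlift (tcls P y) ∈ box (d := θ.D) P := tlift_mem_box _
  have hAy : A y μ = A (tlift (tcls P y)) μ := by rw [show A (tlift (tcls P y)) = A y from hAper.apply_tlift y]
  have h1 : κ * ‖A y μ‖ ^ 2 ≤ bondPairPer τ P A A := by
    rw [hAy]
    refine (hκle (A (tlift (tcls P y)) μ)).trans ?_
    have hterm : ∀ (μ' : Fin θ.D), ∀ x ∈ box (d := θ.D) P, 0 ≤ (τ (star (A x μ') * A x μ')).re :=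
      fun μ' x _ => B9Thm311FlatHermKernelZd.re_trace_star_mul_self_nonneg' hτp _
    calc (τ (star (A (tlift (tcls P y)) μ) * A (tlift (tcls P y)) μ)).re
        ≤ ∑ x ∈ box (d := θ.D) P, (τ (star (A x μ) * A x μ)).re :=
          Finset.single_le_sum (f := fun x => (τ (star (A x μ) * A x μ)).re) (hterm μ) hx₀
      _ ≤ ∑ μ' : Fin θ.D, ∑ x ∈ box (d := θ.D) P, (τ (star (A x μ') * A x μ')).re :=
          Finset.single_le_sum (f := fun μ' : Fin θ.D => ∑ x ∈ box (d := θ.D) P, (τ (star (A x μ') * A x μ')).re)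
            (fun μ' _ => Finset.sum_nonneg (hterm μ')) (Finset.mem_univ μ)
      _ = bondPairPer τ P A A := rfl
  -- combine
  have hc2 : 0 < κ * c ^ 2 := by positivity
  have h2 : ‖A y μ‖ ^ 2 ≤ K * (i.η⁻¹ ^ 3 * nJ) ^ 2 := by
    rw [hK_def, div_mul_eq_mul_div, le_div_iff₀ hc2]
    have h3 : κ * c ^ 2 * ‖A y μ‖ ^ 2 ≤ c ^ 2 * bondPairPer τ P A A := by nlinarith [h1, sq_nonneg c]
    have h4 : c ^ 2 * bondPairPer τ P A A ≤ bondPairPer τ P J J := by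
      have hc2' : c ^ 2 * (c⁻¹ ^ 2 * bondPairPer τ P J J) = bondPairPer τ P J J := by
        rw [← mul_assoc, ← mul_pow, mul_inv_cancel₀ hc.ne', one_pow, one_mul]
      calc c ^ 2 * bondPairPer τ P A A ≤ c ^ 2 * (c⁻¹ ^ 2 * bondPairPer τ P J J) := mul_le_mul_of_nonneg_left hAA (by positivity)
        _ = bondPairPer τ P J J := hc2'
    calc ‖A y μ‖ ^ 2 * (κ * c ^ 2) = κ * c ^ 2 * ‖A y μ‖ ^ 2 := by ring
      _ ≤ bondPairPer τ P J J := h3.trans h4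
      _ ≤ (θ.D : ℝ) * ((box (d := θ.D) P).card : ℝ) * (Cτ * (i.η⁻¹ ^ 3 * nJ) ^ 2) := hJJ
      _ = (θ.D : ℝ) * ((box (d := θ.D) P).card : ℝ) * Cτ * (i.η⁻¹ ^ 3 * nJ) ^ 2 := by ring
  have hmax : K ≤ (max 1 K) ^ 2 := by
    have h1' : (1 : ℝ) ≤ max 1 K := le_max_left _ _
    calc K ≤ max 1 K := le_max_right _ _
      _ = max 1 K * 1 := (mul_one _).symm
      _ ≤ max 1 K * max 1 K := mul_le_mul_of_nonneg_left h1' (by positivity)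
      _ = (max 1 K) ^ 2 := (sq _).symm
  have h5 : ‖A y μ‖ ^ 2 ≤ (max 1 K * i.η⁻¹ ^ 3 * nJ) ^ 2 := by
    calc ‖A y μ‖ ^ 2 ≤ K * (i.η⁻¹ ^ 3 * nJ) ^ 2 := h2
      _ ≤ (max 1 K) ^ 2 * (i.η⁻¹ ^ 3 * nJ) ^ 2 := mul_le_mul_of_nonneg_right hmax (by positivity)
      _ = (max 1 K * i.η⁻¹ ^ 3 * nJ) ^ 2 := by ring
  have hnn : 0 ≤ max 1 K * i.η⁻¹ ^ 3 * nJ := by positivity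
  exact (pow_le_pow_iff_left₀ (norm_nonneg _) hnn two_ne_zero).mp h5

end Pointwise

/-! ## §5  The three global (3.47) entries: `GlobAtIPer` inhabited at every nested periodic member -/

section Glob

open B9SupplySockB9P3ZdH2Per (HolderAtIH2Per)
open B9Eq340HolderZd (hquot AdmPair trans hquot_nonneg)

variable {θ : Stage3Params} [FiniteDimensional ℝ θ.𝔸] (τ : θ.𝔸 →ₗ[ℂ] ℂ) (hτp : ∀ x : θ.𝔸, x ≠ 0 → 0 < (τ (star x * x)).re)
  (hτt : ∀ x y : θ.𝔸, τ (x * y) = τ (y * x)) (hτs : ∀ x : θ.𝔸, τ (star x) = starRingEnd ℂ (τ x)) {P : ℕ} [NeZero P]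

include hτp hτt hτs in
/-- ★★★★ **THE GLOBAL (3.47) BLOCK OF THEOREM 3.3 AT `γ = −3` AND THE HÖLDER BINDER (3.45) (BOTH-POINTS EDITION, ANY EXPONENT `0 ≤ β`) FOR THE GENUINE `G_𝔤^per` AT EVERY
NESTED PERIODIC MEMBER, WITH ONE THRESHOLD `aT`** — `∃ aT B₀ > 0`: `GlobAtIPer P θ.L (opsAllZdPer τ θ.L P (towerBondsP …) ops₀) aT B₀ M a.toZdIdx m` (for every `0 < α₀ ≤ aT`, every
`P`-periodic unitary `U₀ ∈ 𝔄_m({Ω_j}, α₀)` and every periodic Hermitian `J`: `|G J|₍₋₁₎, |∇_{U₀}G J|₍₋₂₎, |Δ_{U₀}G J|₍₋₃₎ ≤ B₀·|J|₍₋₃₎` in the member's region-keyed norms) AND, for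
every `0 ≤ β` and every length with `len v ≥ 1` whenever `len v > 0`, `HolderAtIH2Per P θ.L (opsAllZdPer …) aT (2B₀(Lᵐ)^β) β len M a.toZdIdx m` — the N05 witness slot's
displayed `hglob` and `hhol` AT THE MEMBER.  Both from §4's pointwise bound, which bounds `G J` and (by [B8] (1.1) `‖∇_U f‖ ≤ 2η⁻¹‖f‖_∞`, `‖Δ_U f‖ ≤ 4Dη⁻²‖f‖_∞`) its covariant
derivatives EVERYWHERE, with the weights `(Lʲη) ≤ (Lᵐη)`; the Hölder quotient `|R(U₀(Γ))F(x′) − F(x)|∕(η·len)^β ≤ (‖F x′‖ + ‖F x‖)·η^{−β}` (dag-n06-b g24's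
`holderAtIPer_of_globAtIPer_of_len` read (3.47)'s gradient entry instead and therefore needed «Ω_j = ℤᵈ»; here nothing of the kind).  g24's `globAtIPer_opsAllZdPer_torusIdx` is
the all-torus member. [cite: Balaban1985BackgroundPropagators, (3.45), (3.47) p.398, (3.40) p.397, Thm 3.3 p.399; Balaban1984PropagatorsII, (2.22) p.226; Balaban1985RegularSpaces, (1.59) p.86, (1.7) p.77, (1.3)–(1.6) p.77, (1.31) p.82] -/
theorem IdxB8SubDPer.glob_holderAtIH2Per_opsAllZdPer (hD : 0 < θ.D) {Cτ : ℝ} (hCτ : ∀ x y : θ.𝔸, |(τ (star x * y)).re| ≤ Cτ * ‖x‖ * ‖y‖)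
    (a : IdxB8SubDPer θ P) {m : ℕ} (hm : m ≤ a.toZdIdx.k) (ops₀ : ℝ → ZdIdx θ.D θ.L → ℕ → OpsZd θ.D θ.𝔸) (M : ℝ) :
    ∃ aT : ℝ, 0 < aT ∧ ∃ B₀ : ℝ, 0 < B₀ ∧
      GlobAtIPer P θ.L (opsAllZdPer τ θ.L P (fun k j => towerBondsP θ.L a.toZdIdx.Ω (a.toZdIdx.Λs k) j) ops₀) aT B₀ M a.toZdIdx m ∧
      ∀ β : ℝ, 0 ≤ β → ∀ len : Site θ.D → ℝ, (∀ v : Site θ.D, 0 < len v → 1 ≤ len v) →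
        HolderAtIH2Per P θ.L (opsAllZdPer τ θ.L P (fun k j => towerBondsP θ.L a.toZdIdx.Ω (a.toZdIdx.Λs k) j) ops₀) aT
          (2 * B₀ * (((θ.L : ℝ) ^ m) ^ β)) β len M a.toZdIdx m := by
  have hL2 := θ.two_le_L
  have hL1 : 1 ≤ θ.L := le_trans (by norm_num) hL2
  have hLr : (1 : ℝ) ≤ θ.L := by exact_mod_cast hL1
  set i : ZdIdx θ.D θ.L := a.toZdIdx with hi
  have hη : 0 < i.η := i.hη
  obtain ⟨α, hα, N, hN, h⟩ := IdxB8SubDPer.exists_apply_bound_gopZdHPer_plaqNear τ hτp hτt hτs hD hCτ a hm ops₀ M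
  obtain ⟨S, hS_def⟩ : ∃ S : ℝ, S = (θ.L : ℝ) ^ m * i.η := ⟨_, rfl⟩
  have hS0 : 0 < S := by rw [hS_def]; positivity
  obtain ⟨B₀, hB₀_def⟩ : ∃ B₀ : ℝ, B₀ = S * N + S ^ 2 * (2 * i.η⁻¹ * N) + S ^ 3 * (4 * θ.D * (i.η⁻¹ * (i.η⁻¹ * N))) + 1 := ⟨_, rfl⟩
  have hB₀1 : S * N ≤ B₀ := by
    rw [hB₀_def]
    have : 0 ≤ S ^ 2 * (2 * i.η⁻¹ * N) := by positivity
    have : 0 ≤ S ^ 3 * (4 * θ.D * (i.η⁻¹ * (i.η⁻¹ * N))) := by positivity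
    linarith
  have hB₀2 : S ^ 2 * (2 * i.η⁻¹ * N) ≤ B₀ := by
    rw [hB₀_def]
    have : 0 ≤ S * N := by positivity
    have : 0 ≤ S ^ 3 * (4 * θ.D * (i.η⁻¹ * (i.η⁻¹ * N))) := by positivity
    linarith
  have hB₀3 : S ^ 3 * (4 * θ.D * (i.η⁻¹ * (i.η⁻¹ * N))) ≤ B₀ := by
    rw [hB₀_def]
    have : 0 ≤ S * N := by positivity
    have : 0 ≤ S ^ 2 * (2 * i.η⁻¹ * N) := by positivity
    linarith
  have hB₀pos : 0 < B₀ := by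
    rw [hB₀_def]
    have : 0 ≤ S * N := by positivity
    have : 0 ≤ S ^ 2 * (2 * i.η⁻¹ * N) := by positivity
    have : 0 ≤ S ^ 3 * (4 * θ.D * (i.η⁻¹ * (i.η⁻¹ * N))) := by positivity
    linarith
  have hweight : ∀ (n j : ℕ), j ≤ m → weight θ.L i.η (-(n : ℝ)) j ≤ S ^ n := by
    intro n j hj
    rw [B8ScaledSupNorm.weight_neg_natCast, hS_def]
    exact pow_le_pow_left₀ (by positivity) (mul_le_mul_of_nonneg_right (pow_le_pow_right₀ hLr hj) hη.le) n
  -- the pointwise bound on the class, and the gradient bound it implies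
  have key : ∀ (α₀ : ℝ) (U₀ : Site θ.D → Fin θ.D → θ.𝔸ˣ), (∀ x κ, U₀ x κ ∈ unitaryUnits θ.𝔸) → IsPeriodic P U₀ → 0 < α₀ → α₀ ≤ α →
      InAk θ.L m i.η α₀ i.Ω U₀ → ∀ J ∈ domSubHPer (d := θ.D) (𝔸 := θ.𝔸) P, ∀ (y : Site θ.D) (μ : Fin θ.D),
        ‖(opsAllZdPer τ θ.L P (fun k j => towerBondsP θ.L i.Ω (i.Λs k) j) ops₀ M i m).Gop U₀ J y μ‖ ≤ N * bondNorm θ.L m i.η (-(3 : ℝ)) i.Ω J := by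
    intro α₀ U₀ hU₀ hper hα₀ hα₀T hIn J hJ y μ
    have hnear : ∀ (x : Site θ.D) (κ ν : Fin θ.D), ‖plaqF U₀ κ ν x - 1‖ ≤ α :=
      fun x κ ν => (norm_plaqF_sub_one_le_of_inAk_zero hα₀.le a.Ω_zero hIn κ ν x).trans hα₀T
    exact (h U₀ hU₀ hper hnear).2 J hJ y μ
  refine ⟨α, hα, B₀, hB₀pos, fun α₀ U₀ hU₀ hper hα₀ hα₀T hIn J hJ => ?_, fun β hβ len hlen α₀ U₀ hU₀ hper hα₀ hα₀T hIn J hJ => ?_⟩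
  · -- (3.47): the three global entries
    have hU₀1 : ∀ x κ, U₀ x κ ∈ U1 θ.𝔸 := fun x κ => unitaryUnits_le_U1 (hU₀ x κ)
    obtain ⟨nJ, hnJ_def⟩ : ∃ nJ : ℝ, nJ = bondNorm θ.L m i.η (-(3 : ℝ)) i.Ω J := ⟨_, rfl⟩
    have hnJ0 : 0 ≤ nJ := by rw [hnJ_def]; exact B8ScaledSupNorm.msup_nonneg θ.L m hη.le _ _ _
    obtain ⟨A, hA_def⟩ : ∃ A : Site θ.D → Fin θ.D → θ.𝔸, A = (opsAllZdPer τ θ.L P (fun k j => towerBondsP θ.L i.Ω (i.Λs k) j) ops₀ M i m).Gop U₀ J := ⟨_, rfl⟩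
    have hAb : ∀ (y : Site θ.D) (μ : Fin θ.D), ‖A y μ‖ ≤ N * nJ := fun y μ => by rw [hA_def, hnJ_def]; exact key α₀ U₀ hU₀ hper hα₀ hα₀T hIn J hJ y μ
    rw [← hA_def, ← hnJ_def]
    refine ⟨?_, ?_, ?_⟩
    · have e1 : (-(1 : ℝ)) = -((1 : ℕ) : ℝ) := by norm_num
      refine (B8ScaledSupNorm.msup_le (by positivity) fun j hj b _ => ?_).trans (mul_le_mul_of_nonneg_right hB₀1 hnJ0)
      rw [e1]
      calc weight θ.L i.η (-((1 : ℕ) : ℝ)) j * ‖A b.1 b.2‖ ≤ S ^ 1 * (N * nJ) := mul_le_mul (hweight 1 j hj) (hAb b.1 b.2) (norm_nonneg _) (by positivity)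
        _ = S * N * nJ := by ring
    · have e2 : (-(2 : ℝ)) = -((2 : ℕ) : ℝ) := by norm_num
      refine (B8ScaledSupNorm.msup_le (by positivity) fun j hj q _ => ?_).trans (mul_le_mul_of_nonneg_right hB₀2 hnJ0)
      rw [e2]
      have hDer : ‖covDerivFwd i.η U₀ q.1 (fun z => A z q.2.1) q.2.2‖ ≤ i.η⁻¹ * (N * nJ + N * nJ) :=
        (norm_covDerivFwd_le hη (hU₀1 _ _) _).trans (mul_le_mul_of_nonneg_left (add_le_add (hAb _ _) (hAb _ _)) (inv_nonneg.mpr hη.le))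
      calc weight θ.L i.η (-((2 : ℕ) : ℝ)) j * ‖covDerivFwd i.η U₀ q.1 (fun z => A z q.2.1) q.2.2‖ ≤ S ^ 2 * (i.η⁻¹ * (N * nJ + N * nJ)) :=
            mul_le_mul (hweight 2 j hj) hDer (norm_nonneg _) (by positivity)
        _ = S ^ 2 * (2 * i.η⁻¹ * N) * nJ := by ring
    · have e3 : (-(3 : ℝ)) = -((3 : ℕ) : ℝ) := by norm_num
      refine (B8ScaledSupNorm.msup_le (by positivity) fun j hj b _ => ?_).trans (mul_le_mul_of_nonneg_right hB₀3 hnJ0)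
      rw [e3]
      have hDer : ‖covLap i.η U₀ (fun w => A w b.2) b.1‖ ≤ 4 * θ.D * (i.η⁻¹ * (i.η⁻¹ * (N * nJ))) :=
        norm_covLap_le hη hU₀1 (fun w => hAb w b.2) b.1
      calc weight θ.L i.η (-((3 : ℕ) : ℝ)) j * ‖covLap i.η U₀ (fun w => A w b.2) b.1‖ ≤ S ^ 3 * (4 * θ.D * (i.η⁻¹ * (i.η⁻¹ * (N * nJ)))) :=
            mul_le_mul (hweight 3 j hj) hDer (norm_nonneg _) (by positivity)
        _ = S ^ 3 * (4 * θ.D * (i.η⁻¹ * (i.η⁻¹ * N))) * nJ := by ring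
  · -- (3.45): the Hölder quotient of the covariant gradient, both points in `Ω_j`, from the pointwise gradient bound everywhere
    have hU1 : ∀ y κ, U₀ y κ ∈ U1 θ.𝔸 := fun y κ => unitaryUnits_le_U1 (hU₀ y κ)
    set G := (opsAllZdPer τ θ.L P (fun k j => towerBondsP θ.L i.Ω (i.Λs k) j) ops₀ M i m).Gop U₀ J with hG
    set F : Fin θ.D × Fin θ.D × Site θ.D → θ.𝔸 := fun t => covDerivFwd i.η U₀ t.1 (fun z => G z t.2.1) t.2.2 with hF
    set NJ := bondNorm θ.L m i.η (-(3 : ℝ)) i.Ω J with hNJ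
    have hNJ0 : 0 ≤ NJ := B8ScaledSupNorm.msup_nonneg θ.L m hη.le _ _ _
    have hAb : ∀ (y : Site θ.D) (μ : Fin θ.D), ‖G y μ‖ ≤ N * NJ := fun y μ => key α₀ U₀ hU₀ hper hα₀ hα₀T hIn J hJ y μ
    have hFb : ∀ (ν κ : Fin θ.D) (x : Site θ.D), ‖F (ν, κ, x)‖ ≤ i.η⁻¹ * (N * NJ + N * NJ) := fun ν κ x =>
      (norm_covDerivFwd_le hη (hU1 _ _) _).trans (mul_le_mul_of_nonneg_left (add_le_add (hAb _ _) (hAb _ _)) (inv_nonneg.mpr hη.le))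
    have hpt : ∀ j, j ≤ m → ∀ (ν κ : Fin θ.D) (x : Site θ.D), weight θ.L i.η (-(2 : ℝ)) j * ‖F (ν, κ, x)‖ ≤ B₀ * NJ := by
      intro j hj ν κ x
      have e2 : (-(2 : ℝ)) = -((2 : ℕ) : ℝ) := by norm_num
      rw [e2]
      calc weight θ.L i.η (-((2 : ℕ) : ℝ)) j * ‖F (ν, κ, x)‖ ≤ S ^ 2 * (i.η⁻¹ * (N * NJ + N * NJ)) :=
            mul_le_mul (hweight 2 j hj) (hFb ν κ x) (norm_nonneg _) (by positivity)
        _ = S ^ 2 * (2 * i.η⁻¹ * N) * NJ := by ring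
        _ ≤ B₀ * NJ := mul_le_mul_of_nonneg_right hB₀2 hNJ0
    have hLm0 : (0 : ℝ) ≤ (θ.L : ℝ) ^ m := by positivity
    refine B8ScaledSupNorm.msup_le (by have : 0 ≤ ((θ.L : ℝ) ^ m) ^ β := Real.rpow_nonneg hLm0 β; positivity) fun j hj q hq => ?_
    obtain ⟨ν, κ, x, x'⟩ := q
    have hq0 : 0 ≤ hquot i.η β len U₀ (covDerivFwd i.η U₀ ν fun z => G z κ) (x, x') := hquot_nonneg hη.le β U₀ _ hq.1
    rw [Real.norm_of_nonneg hq0]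
    have hs0 : 0 < (θ.L : ℝ) ^ j * i.η := by positivity
    have hsm : (θ.L : ℝ) ^ j * i.η ≤ (θ.L : ℝ) ^ m * i.η := mul_le_mul_of_nonneg_right (pow_le_pow_right₀ hLr hj) hη.le
    have hwsplit : weight θ.L i.η (-(2 + β)) j = weight θ.L i.η (-(2 : ℝ)) j * ((θ.L : ℝ) ^ j * i.η) ^ β := by
      simp only [weight, neg_neg]
      rw [Real.rpow_add hs0, Real.rpow_two]
    have hwβ : ((θ.L : ℝ) ^ j * i.η) ^ β ≤ ((θ.L : ℝ) ^ m * i.η) ^ β := Real.rpow_le_rpow hs0.le hsm hβ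
    have hηβ : 0 < i.η ^ β := Real.rpow_pos_of_pos hη β
    have hden : i.η ^ β ≤ (i.η * len ((x, x').2 - (x, x').1)) ^ β := by
      apply Real.rpow_le_rpow hη.le _ hβ
      have := hlen _ hq.1.1
      nlinarith
    have hnum : ‖trans U₀ (x, x').1 (x, x').2 ((covDerivFwd i.η U₀ ν fun z => G z κ) (x, x').2) - (covDerivFwd i.η U₀ ν fun z => G z κ) (x, x').1‖ ≤
        ‖F (ν, κ, x')‖ + ‖F (ν, κ, x)‖ := by
      calc _ ≤ ‖trans U₀ (x, x').1 (x, x').2 ((covDerivFwd i.η U₀ ν fun z => G z κ) (x, x').2)‖ + ‖(covDerivFwd i.η U₀ ν fun z => G z κ) (x, x').1‖ :=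
            norm_sub_le _ _
        _ = ‖F (ν, κ, x')‖ + ‖F (ν, κ, x)‖ := by rw [B9Eq340HolderZd.norm_trans hU1]
    have hquo : hquot i.η β len U₀ (covDerivFwd i.η U₀ ν fun z => G z κ) (x, x') ≤ (‖F (ν, κ, x')‖ + ‖F (ν, κ, x)‖) * (i.η ^ β)⁻¹ := by
      rw [B9Eq340HolderZd.hquot_def, div_eq_mul_inv]
      exact mul_le_mul hnum (inv_anti₀ hηβ hden) (inv_nonneg.2 (Real.rpow_nonneg (mul_nonneg hη.le hq.1.1.le) β)) (by positivity)
    have hratio : ((θ.L : ℝ) ^ m * i.η) ^ β * (i.η ^ β)⁻¹ = ((θ.L : ℝ) ^ m) ^ β := by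
      rw [Real.mul_rpow hLm0 hη.le, mul_assoc, mul_inv_cancel₀ hηβ.ne', mul_one]
    have hw2 : 0 ≤ weight θ.L i.η (-(2 : ℝ)) j := B8ScaledSupNorm.weight_nonneg θ.L hη.le _ j
    calc weight θ.L i.η (-(2 + β)) j * hquot i.η β len U₀ (covDerivFwd i.η U₀ ν fun z => G z κ) (x, x')
        ≤ (weight θ.L i.η (-(2 : ℝ)) j * ((θ.L : ℝ) ^ m * i.η) ^ β) * ((‖F (ν, κ, x')‖ + ‖F (ν, κ, x)‖) * (i.η ^ β)⁻¹) := by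
          rw [hwsplit]
          exact mul_le_mul (mul_le_mul_of_nonneg_left hwβ hw2) hquo hq0 (mul_nonneg hw2 (Real.rpow_nonneg (hs0.le.trans hsm) β))
      _ = (((θ.L : ℝ) ^ m * i.η) ^ β * (i.η ^ β)⁻¹) *
            (weight θ.L i.η (-(2 : ℝ)) j * ‖F (ν, κ, x')‖ + weight θ.L i.η (-(2 : ℝ)) j * ‖F (ν, κ, x)‖) := by ring
      _ ≤ ((θ.L : ℝ) ^ m) ^ β * (B₀ * NJ + B₀ * NJ) := by
          rw [hratio]
          exact mul_le_mul_of_nonneg_left (add_le_add (hpt j hj ν κ x') (hpt j hj ν κ x)) (Real.rpow_nonneg hLm0 β)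
      _ = 2 * B₀ * (((θ.L : ℝ) ^ m) ^ β) * NJ := by ring

include hτp hτt hτs in
/-- ★★★★ **THE GLOBAL (3.47) BLOCK AT EVERY NESTED PERIODIC MEMBER** (the `GlobAtIPer` half of `glob_holderAtIH2Per_opsAllZdPer`) — the N05 head's `hglob` at `(a, m)`.
[cite: Balaban1985BackgroundPropagators, (3.47) p.398, Thm 3.3 p.399; Balaban1984PropagatorsII, (2.22) p.226; Balaban1985RegularSpaces, (1.59) p.86, (1.7) p.77, (1.3)–(1.6) p.77, (1.31) p.82] -/
theorem IdxB8SubDPer.globAtIPer_opsAllZdPer (hD : 0 < θ.D) {Cτ : ℝ} (hCτ : ∀ x y : θ.𝔸, |(τ (star x * y)).re| ≤ Cτ * ‖x‖ * ‖y‖)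
    (a : IdxB8SubDPer θ P) {m : ℕ} (hm : m ≤ a.toZdIdx.k) (ops₀ : ℝ → ZdIdx θ.D θ.L → ℕ → OpsZd θ.D θ.𝔸) (M : ℝ) :
    ∃ aT : ℝ, 0 < aT ∧ ∃ B₀ : ℝ, 0 < B₀ ∧
      GlobAtIPer P θ.L (opsAllZdPer τ θ.L P (fun k j => towerBondsP θ.L a.toZdIdx.Ω (a.toZdIdx.Λs k) j) ops₀) aT B₀ M a.toZdIdx m := by
  obtain ⟨aT, haT, B₀, hB₀, hglob, -⟩ := IdxB8SubDPer.glob_holderAtIH2Per_opsAllZdPer τ hτp hτt hτs hD hCτ a hm ops₀ M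
  exact ⟨aT, haT, B₀, hB₀, hglob⟩

omit [NeZero P] in
/-- **THE RECORD'S `Gop` IS PERIODIC HERMITIAN AT EVERY BACKGROUND** (`G_𝔤^per(U₀)J ∈ E_𝔤^per(P)` by construction; any class). [cite: Balaban1985BackgroundPropagators, (3.27) p.395; Balaban1985RegularSpaces, p.77 («Ω_j ⊂ T_η»)] -/
theorem gop_mem_domSubHPer_opsAllZdPer (ΛbP : ℕ → ℕ → Set (Site θ.D × Fin θ.D)) (ops₀ : ℝ → ZdIdx θ.D θ.L → ℕ → OpsZd θ.D θ.𝔸) (M : ℝ) (i : ZdIdx θ.D θ.L)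
    (m : ℕ) (U₀ : Site θ.D → Fin θ.D → θ.𝔸ˣ) (J : Site θ.D → Fin θ.D → θ.𝔸) :
    (opsAllZdPer τ θ.L P ΛbP ops₀ M i m).Gop U₀ J ∈ domSubHPer (d := θ.D) (𝔸 := θ.𝔸) P :=
  gopZdHPer_mem_domSubHPer i.η (opsLandauPer τ P (withDpZd (withQQP τ θ.L ΛbP ops₀)) M i m) P U₀ J

end Glob

end Literature.MathematicalPhysics.QuantumFieldTheory.Balaban1983to89.B9Thm33GlobalBlockWitnessZdPerNested

end
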